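import Mathlib
import Literature.NumberTheory.Automorphic.HilbertModularFormQExpansion
import Summits.Langlands.Langlands.Theorems.CapacityClassicalityHilbertIntegralOverconvergentIsCongruenceStubHolNoZeroDivisors
import Summits.Langlands.Langlands.Theorems.CapacityClassicalityHilbertIntegralOverconvergentIsCongruenceStubModularFormCoeffSupport
import Summits.Langlands.Langlands.Theorems.CapacityClassicalityHilbertIntegralOverconvergentIsCongruenceStubModularFormPeriodic
import Summits.Langlands.Langlands.Theorems.CapacityClassicalityHilbertIntegralOverconvergentIsCongruenceKoecherGlue
import Summits.Langlands.Langlands.Theorems.CapacityClassicalityHilbertIntegralOverconvergentIsCongruenceKoecherPrinciple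
import Summits.Langlands.Langlands.Theorems.CapacityClassicalityHilbertIntegralOverconvergentIsCongruenceAlgebraicIsModular
import Summits.Langlands.Langlands.Theorems.CapacityClassicalityHilbertIntegralOverconvergentIsCongruenceEngineInstanceData
import Summits.Langlands.Langlands.Theorems.CapacityClassicalityHilbertIntegralOverconvergentIsCongruenceRelationToFunctions
import Summits.Langlands.Langlands.Theorems.CapacityClassicalityHilbertIntegralOverconvergentIsCongruenceStubGroupedRelation
import Summits.Langlands.Langlands.Theorems.CapacityClassicalityHilbertIntegralOverconvergentIsCongruenceStubEncMonomial
import Summits.Langlands.Langlands.Theorems.CapacityClassicalityHilbertIntegralOverconvergentIsCongruenceHilbertClassicalityEncodedRelation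

/-!
# Hilbert classicality modulo the named facts — the END-TO-END ASSEMBLY of line `Sketch-ideate-r1-k1`
# for the crux `HilbertIntegralOverconvergentIsCongruence` (stmt-Langlands-8485)

Endpoint of RESHAPE 16 (§ T) of the registered skeleton
`Cruxes/HilbertIntegralOverconvergentIsCongruence/Lines/Sketch_ideate_r1_k1.lean`: the theorem
`hilbertClassicalityModuloNamedFacts` — the refuter-repaired crux C′ TYPED in the vocabulary
`Literature.NumberTheory.Automorphic.HilbertModular`, one complex embedding at a time, proved from TWO named facts of the
theory of Hilbert modular forms (hypotheses `hSt`, `hSup`; the planner files them as items) and the crux's own Katz-expansion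
surrogate (`hKatz`, as the sibling crux α does over `ℚ`).  Everything else — the `d`-free algebraization engine, Serre's
congruence subgroup property, the Götzky–Koecher principle, the Fourier expansion on the tube, the `q`-expansion
dictionary/principle, the transfer, relation ⇒ functions — is a theorem of the tree.  Theorems only, no `sorry`, no `def`.

The named facts, for the record (status in print: crux NOTES):
* (i) `hSt` — the `p`-adic sup-norm Sturm bound for `E`-rational Hilbert modular forms of level `Γ₁(𝔫)` on trace windows
  `{Tr(αν) < L(b)}` affine in `∑_σ |b_σ|` (Sturm's theorem mod `𝔭` on the toroidal boundary + bounded denominators; `d = 1`: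
  Sturm 1987, in the tree; `d = 2`: Burgos Gil–Pacetti).
* (ii) `hSup` — `d + 1` forms of one weight `w₀` with linearly independent monomials of every degree (algebraic independence:
  the Hilbert modular variety has dimension `d = [F:ℚ]`) and one form of weight `w₀ - k` not vanishing on `ℍ`, all with
  `𝓞_E`-integral `E`-rational expansions converging on the tube under every embedding of `E` (`q`-expansion principle, rationality).
-/

set_option linter.dupNamespace false

noncomputable section

namespace Summit.Langlands.Langlands.Theorems.HilbertIntegralOverconvergentIsCongruence

open MeasureTheory Complex NumberField
open Literature.NumberTheory.Automorphic Literature.NumberTheory.Automorphic.HilbertModular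
open scoped MatrixGroups NumberField

/-- **Hilbert classicality modulo the named facts** — the typed repaired crux C′ of
`CapacityClassicality.HilbertIntegralOverconvergentIsCongruence` (stmt-Langlands-8485, informal).  `F` totally real, `1 < [F:ℚ]`,
`𝔫 ≠ 0`, `E` a number field with a complex embedding `τ` and a `p`-adic one `v`, `(d, idx, α, enc)` an ADMISSIBLE ENCODING of
`q`-expansions (`1 ≤ d`, `α ≫ 0`, `idx` injective and additive on the cone `qIndexSet F` with the trace formula `|idx ν| = Tr(αν)`,
`enc f` carrying `fourierCoeff f` — such data exist with `d = [F:ℚ]`: `stub_qIndex_encoding_trace` + `hilbertQExpansionRing`).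
HYPOTHESES: (i) `hSt` the `p`-adic sup-norm Sturm bound for `E`-rational forms of level `Γ₁(𝔫)`; (ii) `hSup` the supply of
`d + 1` forms of weight `w₀` with independent monomials and a form of weight `w₀ - k` non-zero on `ℍ`, with integral `E`-rational
tube-convergent expansions; (iii) `hKatz` a Hasse lift and a Katz datum in the graded family
`V b = span_{ℚ̄_p} {map v A | map τ A = enc f, f ∈ M_b(Γ₁(𝔫))}` converging to the `v`-adic encoded expansion of `c`.
CONCLUSION, for `c : F → E` integral, cone-supported, with `q`-series convergent on the tube under every embedding: for some
`𝔪 ≠ 0` the `q`-series `z ↦ ∑_ν τ(c ν) e^{2πi S(νz)}` (extended by `0` off `ℍ`) is a Hilbert modular form of weight `k` on `Γ₁(𝔪)`,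
and its Fourier coefficients are the `τ(c ν)`.  PROOF: `hcm_encodedRelation` (the engine instance), `relationToFunctions`,
`stub_groupedRelation` (non-triviality from the independence clause of (ii), no zero divisors `stub_hol_noZeroDivisors`) and
`qSeries_mem_modularForms_of_algebraic` (transfer on Serre's CSP + the Koecher principle). [folklore] -/
theorem hilbertClassicalityModuloNamedFacts (F : Type) [Field F] [NumberField F] [NumberField.IsTotallyReal F]
    (hd : 1 < Module.finrank ℚ F) (𝔫 : Ideal (𝓞 F)) (h𝔫 : 𝔫 ≠ ⊥)
    (E : Type) [Field E] [NumberField E] (τ : E →+* ℂ) (p : ℕ) [Fact p.Prime] (v : E →+* PadicAlgCl p)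
    (d : ℕ) (idx : F → (Fin d →₀ ℕ)) (α : F) (enc : (Point F → ℂ) → MvPowerSeries (Fin d) ℂ)
    (hd1 : 1 ≤ d) (hα : ∀ σ : F →+* ℝ, 0 < σ α) (hinj : Set.InjOn idx (qIndexSet F))
    (hadd : ∀ μ ∈ qIndexSet F, ∀ μ' ∈ qIndexSet F, idx (μ + μ') = idx μ + idx μ')
    (htrace : ∀ ν ∈ qIndexSet F, ((∑ j, idx ν j : ℕ) : ℚ) = Algebra.trace ℚ F (α * ν))
    (henc : ∀ f : Point F → ℂ, (∀ μ ∈ qIndexSet F, MvPowerSeries.coeff (idx μ) (enc f) = fourierCoeff f μ) ∧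
      ∀ n, (∀ μ ∈ qIndexSet F, idx μ ≠ n) → MvPowerSeries.coeff n (enc f) = 0)
    (hSt : ∃ (L : ((F →+* ℝ) → ℤ) → ℕ) (cS : ℝ), (∀ b, (L b : ℝ) ≤ cS * (∑ σ, |(b σ : ℝ)| + 1)) ∧
      ∀ (b : (F →+* ℝ) → ℤ) (f : Point F → ℂ), f ∈ modularForms (Bianchi.Gamma1 𝔫) b →
      ∀ q : F → E, (∀ ν ∈ qIndexSet F, fourierCoeff f ν = τ (q ν)) →
      ∀ B : ℝ, 0 ≤ B →
        (∀ ν ∈ qIndexSet F, ((Algebra.trace ℚ F (α * ν) : ℚ) : ℝ) < L b → ‖v (q ν)‖ ≤ B) →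
        ∀ ν ∈ qIndexSet F, ‖v (q ν)‖ ≤ B)
    (k : (F →+* ℝ) → ℤ)
    (hSup : ∃ (w₀ : (F →+* ℝ) → ℤ) (gf : Fin (d + 1) → Point F → ℂ) (qg : Fin (d + 1) → F → E) (G : Point F → ℂ)
      (qG : F → E),
      (∀ l, gf l ∈ modularForms (Bianchi.Gamma1 𝔫) w₀) ∧ G ∈ modularForms (Bianchi.Gamma1 𝔫) (w₀ - k) ∧
      (∃ z ∈ halfSpace F, G z ≠ 0) ∧
      (∀ l, ∀ ν ∈ qIndexSet F, fourierCoeff (gf l) ν = τ (qg l ν)) ∧ (∀ ν ∈ qIndexSet F, fourierCoeff G ν = τ (qG ν)) ∧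
      (∀ l ν, IsIntegral ℤ (qg l ν)) ∧ (∀ ν, IsIntegral ℤ (qG ν)) ∧
      (∀ l (τ' : E →+* ℂ) (y : (F →+* ℝ) → ℝ), (∀ σ, 0 < y σ) →
        Summable (fun ν : {ν : F | ∀ b : 𝓞 F, ∃ n : ℤ, Algebra.trace ℚ F (ν * b) = n} ↦
          ‖τ' (qg l ν)‖ * Real.exp (-(2 * Real.pi * ∑ σ : F →+* ℝ, σ (ν : F) * y σ)))) ∧
      (∀ (τ' : E →+* ℂ) (y : (F →+* ℝ) → ℝ), (∀ σ, 0 < y σ) →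
        Summable (fun ν : {ν : F | ∀ b : 𝓞 F, ∃ n : ℤ, Algebra.trace ℚ F (ν * b) = n} ↦
          ‖τ' (qG ν)‖ * Real.exp (-(2 * Real.pi * ∑ σ : F →+* ℝ, σ (ν : F) * y σ)))) ∧
      ∀ (m : ℕ) (κ : Sym (Fin (d + 1)) m → ℂ),
        (∀ z ∈ halfSpace F, ∑ s, κ s * ((s : Multiset (Fin (d + 1))).map (fun l ↦ gf l z)).prod = 0) → ∀ s, κ s = 0)
    (c : F → E) (hc_int : ∀ ν, IsIntegral ℤ (c ν)) (hc_supp : ∀ ν ∉ qIndexSet F, c ν = 0)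
    (harch_c : ∀ (τ' : E →+* ℂ) (y : (F →+* ℝ) → ℝ), (∀ σ, 0 < y σ) →
      Summable (fun ν : {ν : F | ∀ b : 𝓞 F, ∃ n : ℤ, Algebra.trace ℚ F (ν * b) = n} ↦
        ‖τ' (c ν)‖ * Real.exp (-(2 * Real.pi * ∑ σ : F →+* ℝ, σ (ν : F) * y σ))))
    (hKatz : ∃ (t : (F →+* ℝ) → ℤ) (e : MvPowerSeries (Fin d) (PadicAlgCl p)) (a : ℕ → MvPowerSeries (Fin d) (PadicAlgCl p))
      (ρ C : ℝ), t ≠ 0 ∧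
      e ∈ Submodule.span (PadicAlgCl p)
        {ψ | ∃ (A : MvPowerSeries (Fin d) E) (f : Point F → ℂ), f ∈ modularForms (Bianchi.Gamma1 𝔫) t ∧
          MvPowerSeries.map τ A = enc f ∧ ψ = MvPowerSeries.map v A} ∧
      MvPowerSeries.constantCoeff e = 1 ∧ (∀ n, ‖MvPowerSeries.coeff n e‖ ≤ 1) ∧
      (∀ i : ℕ, a i ∈ Submodule.span (PadicAlgCl p)
        {ψ | ∃ (A : MvPowerSeries (Fin d) E) (f : Point F → ℂ), f ∈ modularForms (Bianchi.Gamma1 𝔫) (k + i • t) ∧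
          MvPowerSeries.map τ A = enc f ∧ ψ = MvPowerSeries.map v A}) ∧
      0 < ρ ∧ ρ < 1 ∧ 0 ≤ C ∧ (∀ i n, ‖MvPowerSeries.coeff n (a i)‖ ≤ C * ρ ^ i) ∧
      (∀ ν ∈ qIndexSet F, HasSum (fun i : ℕ ↦ MvPowerSeries.coeff (idx ν) (a i * e⁻¹ ^ i)) (v (c ν))) ∧
      ∀ n, (∀ ν ∈ qIndexSet F, idx ν ≠ n) → HasSum (fun i : ℕ ↦ MvPowerSeries.coeff n (a i * e⁻¹ ^ i)) 0) :
    (∃ 𝔪 : Ideal (𝓞 F), 𝔪 ≠ ⊥ ∧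
      (halfSpace F).indicator (fun z ↦
        ∑' ν : {ν : F | ∀ b : 𝓞 F, ∃ n : ℤ, Algebra.trace ℚ F (ν * b) = n},
          τ (c ν) * cexp (2 * Real.pi * I * pairing (ν : F) z)) ∈ modularForms (Bianchi.Gamma1 𝔪) k) ∧
    ∀ ν : F, (∀ b : 𝓞 F, ∃ n : ℤ, Algebra.trace ℚ F (ν * b) = n) → ∀ y : (F →+* ℝ) → ℝ, (∀ σ, 0 < y σ) →
      fourierCoeffAt ((halfSpace F).indicator (fun z ↦
        ∑' ν : {ν : F | ∀ b : 𝓞 F, ∃ n : ℤ, Algebra.trace ℚ F (ν * b) = n},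
          τ (c ν) * cexp (2 * Real.pi * I * pairing (ν : F) z))) ν y = τ (c ν) := by
  classical
  obtain ⟨w₀, gf, qg, G₁, qG, hgf, hG₁, hG₁0, hqg, hqG, hqg_int, hqG_int, hqg_arch, hqG_arch, hindep⟩ := hSup
  /- ### the engine instance -/
  obtain ⟨D, hD1, P', hP'0, hrelΓ⟩ := hcm_encodedRelation F hd 𝔫 h𝔫 E τ p v d idx α enc hd1 hα hinj hadd htrace henc hSt
    k w₀ gf qg G₁ qG hgf hG₁ hqg hqG hqg_int hqG_int hqg_arch hqG_arch c hc_int harch_c hKatz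
  /- ### graded-ring properties of `enc` on modular forms (§ P, parametric; uniqueness of encodings) -/
  obtain ⟨enc₀, henc₀, hmul, -⟩ := eid_qexpRing_of_dict F hd 𝔫 h𝔫 d idx hinj hadd (eid_dict_of_idx F d idx hinj hadd)
  have enc_ext : ∀ (f : Point F → ℂ) (Q : MvPowerSeries (Fin d) ℂ),
      (∀ μ ∈ qIndexSet F, MvPowerSeries.coeff (idx μ) Q = fourierCoeff f μ) →
      (∀ n, (∀ μ ∈ qIndexSet F, idx μ ≠ n) → MvPowerSeries.coeff n Q = 0) → Q = enc f := by
    intro f Q hQ hQ0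
    ext n
    by_cases hn : ∃ μ ∈ qIndexSet F, idx μ = n
    · obtain ⟨μ, hμ, rfl⟩ := hn
      rw [hQ μ hμ, (henc f).1 μ hμ]
    · push Not at hn
      rw [hQ0 n hn, (henc f).2 n hn]
  have hencEq : enc = enc₀ := funext fun f ↦ (enc_ext f (enc₀ f) (henc₀ f).1 (henc₀ f).2).symm
  rw [← hencEq] at hmul
  /- ### the `q`-series of `τ ∘ c` and its cone-class package (§ M) -/
  obtain ⟨hqhol, hqper, hqcoef⟩ := qSeriesPackage F (fun ν ↦ τ (c ν)) (harch_c τ)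
  set qser : Point F → ℂ := fun z ↦ ∑' ν : {ν : F | ∀ b : 𝓞 F, ∃ n : ℤ, Algebra.trace ℚ F (ν * b) = n},
      τ (c ν) * cexp (2 * Real.pi * I * pairing (ν : F) z) with hqser
  set γ : Point F → ℂ := (halfSpace F).indicator qser with hγdef
  have hγeq : ∀ z ∈ halfSpace F, γ z = qser z := fun z hz ↦ Set.indicator_of_mem hz _
  have hγzero : ∀ z ∉ halfSpace F, γ z = 0 := fun z hz ↦ Set.indicator_of_notMem hz _
  have hγhol : IsHolomorphicOn F γ := hqhol.congr hγeq
  have hγper : ∀ (a' : 𝓞 F) (z : Point F), z ∈ halfSpace F → γ (fun σ ↦ z σ + ((σ (a' : F) : ℝ) : ℂ)) = γ z := by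
    intro a' z hz
    have hz' : (fun σ ↦ z σ + ((σ (a' : F) : ℝ) : ℂ)) ∈ halfSpace F := fun σ ↦ by simpa using hz σ
    rw [hγeq _ hz', hγeq z hz]
    exact hqper a' z hz
  have hγcoef : ∀ ν : F, (∀ b : 𝓞 F, ∃ n : ℤ, Algebra.trace ℚ F (ν * b) = n) → fourierCoeff γ ν = τ (c ν) := by
    intro ν hν
    rw [fourierCoeff_eq]
    have : fourierCoeffAt γ ν (fun _ ↦ 1) = fourierCoeffAt qser ν (fun _ ↦ 1) := by
      refine setIntegral_congr_fun measurableSet_Icc fun x _ ↦ ?_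
      rw [hγeq _ (koe_cubePoint_mem_halfSpace x (fun _ ↦ one_pos))]
    rw [this]
    exact hqcoef ν hν _ (fun _ ↦ one_pos)
  have hγcone : IsHolomorphicOn F γ ∧
      (∀ (a' : 𝓞 F) (z : Point F), z ∈ halfSpace F → γ (fun σ ↦ z σ + ((σ (a' : F) : ℝ) : ℂ)) = γ z) ∧
      ∀ μ : F, (∀ a' : 𝓞 F, ∃ n : ℤ, Algebra.trace ℚ F (μ * a') = n) → μ ∉ qIndexSet F → fourierCoeff γ μ = 0 :=
    ⟨hγhol, hγper, fun μ hμ hμc ↦ by rw [hγcoef μ hμ, hc_supp μ hμc, map_zero]⟩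
  -- the relation among encodings, at `Γ = enc γ`
  have hrelEnc₀ := hrelΓ (enc γ) (fun ν hν ↦ by rw [(henc γ).1 ν hν, hγcoef ν hν.1]) (henc γ).2
  /- ### modular forms are in the cone class (P1, P5); monomials × powers are forms (`stub_enc_monomial`) -/
  have formCone : ∀ (b : (F →+* ℝ) → ℤ) (φ : Point F → ℂ), φ ∈ modularForms (Bianchi.Gamma1 𝔫) b →
      IsHolomorphicOn F φ ∧
      (∀ (a' : 𝓞 F) (z : Point F), z ∈ halfSpace F → φ (fun σ ↦ z σ + ((σ (a' : F) : ℝ) : ℂ)) = φ z) ∧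
      ∀ μ : F, (∀ a' : 𝓞 F, ∃ n : ℤ, Algebra.trace ℚ F (μ * a') = n) → μ ∉ qIndexSet F → fourierCoeff φ μ = 0 :=
    fun b φ hφ ↦ ⟨hφ.holomorphic, stub_modularForm_periodic F 𝔫 b φ hφ,
      fun μ hμ hμc ↦ stub_modularForm_coeff_support F hd 𝔫 h𝔫 b φ hφ μ hμ hμc⟩
  have hmono : ∀ (j : ℕ) (s : Multiset (Fin (d + 1))), s ≠ 0 →
      (s.map gf).prod * G₁ ^ j ∈ modularForms (Bianchi.Gamma1 𝔫) (Multiset.card s • w₀ + j • (w₀ - k)) ∧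
      enc ((s.map gf).prod * G₁ ^ j) = (s.map (fun l ↦ enc (gf l))).prod * enc G₁ ^ j := by
    intro j s hs
    obtain ⟨hsmem, hsenc⟩ := stub_enc_monomial F 𝔫 d enc hmul w₀ gf hgf s hs
    rcases Nat.eq_zero_or_pos j with rfl | hj
    · simp only [pow_zero, mul_one, zero_nsmul, add_zero]
      exact ⟨hsmem, hsenc⟩
    · have hrep : Multiset.replicate j () ≠ 0 := by
        intro h
        have h' := congrArg Multiset.card h
        rw [Multiset.card_replicate, Multiset.card_zero] at h'
        omega
      obtain ⟨hGmem, hGenc⟩ := stub_enc_monomial F 𝔫 d enc hmul (w₀ - k) (fun _ : Unit ↦ G₁) (fun _ ↦ hG₁)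
        (Multiset.replicate j ()) hrep
      simp only [Multiset.map_replicate, Multiset.prod_replicate, Multiset.card_replicate] at hGmem hGenc
      refine ⟨mul_mem_modularForms hsmem hGmem, ?_⟩
      rw [hmul _ _ _ _ hsmem hGmem, hsenc, hGenc]
  /- ### RELATION ⇒ FUNCTIONS (§ S) -/
  set φf : ((j : Fin D) × Sym (Fin (d + 1)) (D - j)) → Point F → ℂ := fun u ↦
    ((u.2 : Multiset (Fin (d + 1))).map gf).prod * G₁ ^ (u.1 : ℕ) with hφf
  have hsne : ∀ u : (j : Fin D) × Sym (Fin (d + 1)) (D - j), (u.2 : Multiset (Fin (d + 1))) ≠ 0 := by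
    intro u h
    have h' := congrArg Multiset.card h
    rw [Sym.card_coe, Multiset.card_zero] at h'
    have := u.1.isLt
    omega
  have hφmem : ∀ u : (j : Fin D) × Sym (Fin (d + 1)) (D - j),
      φf u ∈ modularForms (Bianchi.Gamma1 𝔫) (D • w₀ - (u.1 : ℕ) • k) := by
    intro u
    rw [← hcm_nsmul_weight w₀ k D u.1 u.1.isLt.le, ← Sym.card_coe (s := u.2)]
    exact (hmono u.1 _ (hsne u)).1
  have hrelEnc : ∑ u, P' u • (enc (φf u) * enc γ ^ (u.1 : ℕ)) = 0 := by
    rw [← hrelEnc₀]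
    refine Finset.sum_congr rfl fun u _ ↦ ?_
    simp only [hφf]
    rw [(hmono _ _ (hsne u)).2]
  have hrelFun := relationToFunctions F d idx hinj hadd enc henc _ φf γ P' (fun u ↦ (u.1 : ℕ))
    (fun u ↦ formCone _ _ (hφmem u)) hγcone hrelEnc
  /- ### grouping by powers of `γ` and non-triviality (`stub_groupedRelation`) -/
  set Fm : ℕ → Point F → ℂ := fun j z ↦ if h : j < D then
      ∑ s : Sym (Fin (d + 1)) (D - j),
        P' ⟨⟨j, h⟩, s⟩ * ((((s : Multiset (Fin (d + 1))).map (fun l ↦ gf l z)).prod) * G₁ z ^ j)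
    else 0 with hFmdef
  obtain ⟨hgroup, j₀, hj₀D, z₀, hz₀, hFm0⟩ := stub_groupedRelation F d D gf G₁ γ (fun l ↦ (hgf l).holomorphic)
    hG₁.holomorphic hG₁0 (stub_hol_noZeroDivisors F) hindep P' hP'0 Fm (fun j z ↦ rfl)
  have hrel' : ∀ z ∈ halfSpace F, ∑ j ∈ Finset.range (D - 1 + 1), Fm j z * γ z ^ j = 0 := by
    intro z hz
    rw [Nat.sub_add_cancel hD1, hgroup z, ← hrelFun z hz]
    refine Finset.sum_congr rfl fun u _ ↦ ?_
    simp only [hφf, Pi.mul_apply, Pi.pow_apply, Pi.multiset_prod_apply, Multiset.map_map, Function.comp_def]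
  have hFmMem : ∀ j ≤ D - 1, Fm j ∈ modularForms (Bianchi.Gamma1 𝔫) (D • w₀ - j • k) := by
    intro j hj
    have hjD : j < D := by omega
    have hFmj : Fm j = ∑ s : Sym (Fin (d + 1)) (D - j), P' ⟨⟨j, hjD⟩, s⟩ • φf ⟨⟨j, hjD⟩, s⟩ := by
      funext z
      simp only [hFmdef, dif_pos hjD]
      rw [Finset.sum_apply]
      refine Finset.sum_congr rfl fun s _ ↦ ?_
      simp only [hφf, Pi.smul_apply, smul_eq_mul, Pi.mul_apply, Pi.pow_apply, Pi.multiset_prod_apply,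
        Multiset.map_map, Function.comp_def]
    rw [hFmj]
    exact Submodule.sum_mem _ fun s _ ↦ Submodule.smul_mem _ _ (hφmem ⟨⟨j, hjD⟩, s⟩)
  have hb : ∀ j ≤ D - 1, (D • w₀ - j • k) + j • k = D • w₀ - 0 • k := fun j _ ↦ by
    rw [zero_nsmul, sub_zero, sub_add_cancel]
  have hFm0' : ∃ j ≤ D - 1, ∃ z ∈ halfSpace F, Fm j z ≠ 0 := ⟨j₀, by omega, z₀, hz₀, hFm0⟩
  /- ### ALGEBRAIC ⇒ MODULAR (§ N) -/
  obtain ⟨hmod, hcoefId⟩ := qSeries_mem_modularForms_of_algebraic F hd (fun ν ↦ τ (c ν)) (harch_c τ) γ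
    (fun z hz ↦ hγeq z hz) hγzero 𝔫 h𝔫 k (D - 1) (fun j ↦ D • w₀ - j • k) hb Fm hFmMem hFm0' hrel'
  exact ⟨hmod, hcoefId⟩

end Summit.Langlands.Langlands.Theorems.HilbertIntegralOverconvergentIsCongruence

end
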